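import Summits.QuantumAdvantage.QuantumAdvantage.Theorems.LinnikCubicClassGroupsDegreeOnePrimesEscapeCMClassNumber
import Summits.QuantumAdvantage.QuantumAdvantage.Theorems.LinnikCubicClassGroupsDegreeOnePrimesEscapeTatuzawa
import HarnessLib

/-!
# The relative class number of CM fields, EXPLICIT up to one exceptional quadratic field (Tatuzawa)

Topic `Summits/QuantumAdvantage/QuantumAdvantage/Theorems`, helper file for the crux
`DegreeOnePrimesEscape` (stmt-QuantumAdvantage-11543, closed) of route `LinnikCubicClassGroups`;
cell B2b-1 (linnik-cubic), PART A. HONEST FRAMING: the value of this file is a THEOREM (explicit,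
kernel-checked constants) — NOT summit progress.

Continuation of `…CMClassNumber.lean` (Brauer–Siegel for `h_K/h_{K⁺}` with an ineffective constant).
Here the dependence on the residue lower bound is isolated:

* `classNumber_ge_of_residue_ge` — for a CM field `K` with `[K⁺:ℚ] = n ≥ 2` and ANY bound
  `κ_K ≥ C|d_K|^{−ε/2}`: `h_K ≥ C·(ε/(2(n−1)))^{n−1}/(2^{2n}e^{1/2}π^n) · |d_K|^{1/4−ε} · h_{K⁺}`
  (the regulator ratio, `w_{K⁺} = 2 ≤ w_K`, `|d_{K⁺}|² ≤ |d_K|`, Landau's `κ_{K⁺} ≤ 2^{n+1}e^{1/2}log^{n−1}|d_{K⁺}|`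
  and `log^{n−1} d ≤ d^{ε/2}(2(n−1)/ε)^{n−1}`);

and fed with the tree's EXPLICIT Tatuzawa–Stark residue bound
(`exists_tatuzawa_exceptional_absDiscr_residue`: one exceptional quadratic discriminant `M₀(ε)`,
`κ_K ≥ e^{−7}16^{−N}(C_T ε⁵/(1000·N!))/2 · |d_K|^{−ε}` for every `K` of degree `N` whose quadratic
subfields avoid `M₀`, `C_T = c_E/(2592 B)` explicit):

* `exists_exceptional_classNumber_ge_explicit` — **for `0 < ε ≤ 1` there is ONE natural number
  `M₀` such that for every `n ≥ 2` and every CM field `K` of degree `2n` none of whose quadratic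
  subfields has `|d_k| = M₀`,
  `h_K ≥ c(n,ε) · |d_K|^{1/4−ε} · h_{K⁺}` with the EXPLICIT
  `c(n,ε) = e^{−7}16^{−2n}·(C_T(ε/2)⁵/(1000(2n)!))/2 · (ε/(2(n−1)))^{n−1}/(2^{2n}e^{1/2}π^n)`**;
  in particular (`exists_exceptional_classNumber_ge_explicit'`) `h_K ≥ c(n,ε)|d_K|^{1/4−ε}`.

This is the Stark–Hoffstein phenomenon "the class number of CM fields is effectively large, with at
most one exceptional field per scale" in kernel-checked form (Stark 1974 Thm. 2 has the effective
`h_K > c(n)^{…} d_K^{1/2−1/n}/d_{K⁺}^{…}` for `n` large; Hoffstein 1979 made the constants explicit).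

## References

* H. M. Stark, *Some effective cases of the Brauer–Siegel theorem*, Invent. Math. 23 (1974)
  135–152, Thm. 2. [Stark1974]
* T. Tatuzawa, *On a theorem of Siegel*, Jap. J. Math. 21 (1951) 163–178. [Tatuzawa1951]
-/

noncomputable section

open scoped NumberField
open Complex Filter Topology Set NumberField NumberField.InfinitePlace NumberField.Units

namespace Summit.QuantumAdvantage.QuantumAdvantage.Theorems.DegreeOnePrimesEscape

namespace CMField

open Literature.NumberTheory.LFunctions Literature.NumberTheory.LFunctions.Siegel

/-- **From a residue lower bound to a relative class number lower bound.**  Let `K` be a CM field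
with `[K⁺:ℚ] = n ≥ 2`, and suppose `κ_K ≥ C|d_K|^{−ε/2}` with `C ≥ 0`, `ε > 0`.  Then
`h_K ≥ C·(ε/(2(n−1)))^{n−1}/(2^{2n}e^{1/2}π^n) · |d_K|^{1/4−ε} · h_{K⁺}`.
[cite: Stark1974, Thm. 2 (context)] -/
theorem classNumber_ge_of_residue_ge (K : Type) [Field K] [NumberField K] [IsCMField K] {n : ℕ}
    (hn : 2 ≤ n) (hnF : Module.finrank ℚ (maximalRealSubfield K) = n) {C ε : ℝ} (hC : 0 ≤ C)
    (hε : 0 < ε) (hκ : C * ((discr K).natAbs : ℝ) ^ (-(ε / 2)) ≤ dedekindZeta_residue K) :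
    C * (ε / (2 * ((n : ℝ) - 1))) ^ (n - 1) / (2 ^ (2 * n) * Real.exp (1 / 2) * Real.pi ^ n) *
        ((discr K).natAbs : ℝ) ^ (1 / 4 - ε) * (classNumber (maximalRealSubfield K) : ℝ) ≤
      classNumber K := by
  -- `δ (n − 1) = ε/2`
  set δ : ℝ := ε / (2 * ((n : ℝ) - 1)) with hδ_def
  have hn1 : (0 : ℝ) < (n : ℝ) - 1 := by
    have : (2 : ℝ) ≤ n := by exact_mod_cast hn
    linarith
  have hδ : 0 < δ := by positivity
  set A : ℝ := 2 ^ (n + 1) * Real.exp (1 / 2) with hA_def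
  have hA : 0 < A := by positivity
  have hπ0 := Real.pi_pos
  -- notation and sizes
  have hnF2 : 1 < Module.finrank ℚ (maximalRealSubfield K) := by omega
  set dK : ℝ := ((discr K).natAbs : ℝ) with hdK
  set dF : ℝ := ((discr (maximalRealSubfield K)).natAbs : ℝ) with hdF
  have hdK3 : (3 : ℝ) ≤ dK := by
    rw [hdK]
    exact_mod_cast Literature.NumberTheory.LFunctions.NumberField.three_le_natAbs_discr K
      (by rw [finrank_eq_two_mul K]; omega)
  have hdF3 : (3 : ℝ) ≤ dF := by
    rw [hdF]; exact_mod_cast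
      Literature.NumberTheory.LFunctions.NumberField.three_le_natAbs_discr (maximalRealSubfield K) hnF2
  have hdK1 : (1 : ℝ) < dK := by linarith
  have hdF1 : (1 : ℝ) < dF := by linarith
  have hdK0 : (0 : ℝ) < dK := by linarith
  have hdF0 : (0 : ℝ) < dF := by linarith
  -- the residues
  have hκK : C * dK ^ (-(ε / 2)) ≤ dedekindZeta_residue K := hκ
  have hκF : dedekindZeta_residue (maximalRealSubfield K) ≤ A * Real.log dF ^ (n - 1) := by
    have := Residue.residue_le_log_pow (maximalRealSubfield K) hnF2
    rw [hnF] at this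
    simpa [hA_def, hdF] using this
  -- `log d_F ≤ log d_K`, `(log d_K)^{n−1} ≤ d_K^{ε/2} / δ^{n−1}`
  have hdFK : dF ≤ dK := by
    have h := natAbs_discr_sq_le K
    have h' : dF ^ 2 ≤ dK := by rw [hdF, hdK]; exact_mod_cast h
    nlinarith
  have hlogF : Real.log dF ≤ Real.log dK := Real.log_le_log hdF0 hdFK
  have hlogF0 : 0 ≤ Real.log dF := Real.log_nonneg hdF1.le
  have hlogpow : Real.log dF ^ (n - 1) ≤ dK ^ (ε / 2) / δ ^ (n - 1) := by
    have h1 : Real.log dF ^ (n - 1) ≤ Real.log dK ^ (n - 1) :=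
      pow_le_pow_left₀ hlogF0 hlogF _
    have h2 : Real.log dK ≤ dK ^ δ / δ := Real.log_le_rpow_div hdK0.le hδ
    have h3 : Real.log dK ^ (n - 1) ≤ (dK ^ δ / δ) ^ (n - 1) :=
      pow_le_pow_left₀ (Real.log_nonneg hdK1.le) h2 _
    have h4 : (dK ^ δ / δ) ^ (n - 1) = dK ^ (ε / 2) / δ ^ (n - 1) := by
      rw [div_pow, ← Real.rpow_natCast (dK ^ δ), ← Real.rpow_mul hdK0.le]
      congr 2
      rw [hδ_def, Nat.cast_sub (by omega : 1 ≤ n)]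
      push_cast
      field_simp
    linarith [h4 ▸ h3]
  have hκF' : dedekindZeta_residue (maximalRealSubfield K) ≤ A * (dK ^ (ε / 2) / δ ^ (n - 1)) :=
    hκF.trans (mul_le_mul_of_nonneg_left hlogpow hA.le)
  -- `√d_F ≤ d_K^{1/4}`, `√d_K = d_K^{1/2}`
  have hsqF : Real.sqrt dF ≤ dK ^ (1 / 4 : ℝ) := by
    have h := absdiscr_maximalRealSubfield_le_rpow K
    rw [← hdF, ← hdK] at h
    calc Real.sqrt dF ≤ Real.sqrt (dK ^ (1 / 2 : ℝ)) := Real.sqrt_le_sqrt h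
      _ = dK ^ (1 / 4 : ℝ) := by
        rw [Real.sqrt_eq_rpow, ← Real.rpow_mul hdK0.le]; norm_num
  have hsqK : Real.sqrt dK = dK ^ (1 / 2 : ℝ) := Real.sqrt_eq_rpow dK
  -- regulators and roots of unity
  have hRK := regulator_pos K
  have hRF := regulator_pos (maximalRealSubfield K)
  have hreg : regulator K ≤ 2 ^ (n - 1) * regulator (maximalRealSubfield K) := by
    have := regulator_le K; rwa [hnF] at this
  have hwK : (2 : ℝ) ≤ torsionOrder K := by
    have h2 : 2 ≤ torsionOrder K := by
      obtain ⟨k, hk⟩ := even_torsionOrder K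
      have := torsionOrder_pos K
      omega
    exact_mod_cast h2
  -- the two class number formulas
  have hhK := classNumber_eq K
  have hhF := classNumber_maximalRealSubfield_eq K
  rw [hnF] at hhK hhF
  rw [← hdK] at hhK
  rw [← hdF] at hhF
  have hκK0 : 0 < dedekindZeta_residue K := dedekindZeta_residue_pos K
  have hκF0 : 0 < dedekindZeta_residue (maximalRealSubfield K) := dedekindZeta_residue_pos _
  -- lower bound for `h_K`:  `h_K ≥ C d_K^{−ε/2} · 2 d_K^{1/2} / ((2π)^n 2^{n−1} R_F)`
  have hK_lower : C * dK ^ (-(ε / 2)) * (2 * dK ^ (1 / 2 : ℝ)) /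
      ((2 * Real.pi) ^ n * (2 ^ (n - 1) * regulator (maximalRealSubfield K))) ≤ classNumber K := by
    rw [hhK, hsqK]
    have hnum : C * dK ^ (-(ε / 2)) * (2 * dK ^ (1 / 2 : ℝ)) ≤
        dedekindZeta_residue K * ((torsionOrder K : ℝ) * dK ^ (1 / 2 : ℝ)) := by
      have h1 : 2 * dK ^ (1 / 2 : ℝ) ≤ (torsionOrder K : ℝ) * dK ^ (1 / 2 : ℝ) :=
        mul_le_mul_of_nonneg_right hwK (by positivity)
      have h0 : 0 ≤ C * dK ^ (-(ε / 2)) := by positivity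
      calc C * dK ^ (-(ε / 2)) * (2 * dK ^ (1 / 2 : ℝ))
          ≤ C * dK ^ (-(ε / 2)) * ((torsionOrder K : ℝ) * dK ^ (1 / 2 : ℝ)) :=
            mul_le_mul_of_nonneg_left h1 h0
        _ ≤ dedekindZeta_residue K * ((torsionOrder K : ℝ) * dK ^ (1 / 2 : ℝ)) :=
            mul_le_mul_of_nonneg_right hκK (by positivity)
    have hden : (2 * Real.pi) ^ n * regulator K ≤
        (2 * Real.pi) ^ n * (2 ^ (n - 1) * regulator (maximalRealSubfield K)) :=
      mul_le_mul_of_nonneg_left hreg (by positivity)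
    exact div_le_div₀ (by positivity) hnum (by positivity) hden
  -- upper bound for `h_F`:  `h_F ≤ A (d_K^{ε/2}/δ^{n−1}) · 2 d_K^{1/4} / (2^n R_F)`
  have hF_upper : (classNumber (maximalRealSubfield K) : ℝ) ≤
      A * (dK ^ (ε / 2) / δ ^ (n - 1)) * (2 * dK ^ (1 / 4 : ℝ)) /
        (2 ^ n * regulator (maximalRealSubfield K)) := by
    rw [hhF]
    gcongr
  -- comparison of the two explicit quantities
  have hfinal : C * δ ^ (n - 1) / (2 ^ (2 * n) * Real.exp (1 / 2) * Real.pi ^ n) *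
      dK ^ (1 / 4 - ε) *
      (A * (dK ^ (ε / 2) / δ ^ (n - 1)) * (2 * dK ^ (1 / 4 : ℝ)) /
        (2 ^ n * regulator (maximalRealSubfield K))) =
      C * dK ^ (-(ε / 2)) * (2 * dK ^ (1 / 2 : ℝ)) /
        ((2 * Real.pi) ^ n * (2 ^ (n - 1) * regulator (maximalRealSubfield K))) := by
    -- powers of `d_K`: `d^{1/4−ε} · d^{ε/2} · d^{1/4} = d^{−ε/2} · d^{1/2}`
    have hpow : dK ^ (1 / 4 - ε) * dK ^ (ε / 2) * dK ^ (1 / 4 : ℝ) =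
        dK ^ (-(ε / 2)) * dK ^ (1 / 2 : ℝ) := by
      rw [← Real.rpow_add hdK0, ← Real.rpow_add hdK0, ← Real.rpow_add hdK0]
      norm_num
      ring_nf
    have hP5 : dK ^ (1 / 2 : ℝ) ≠ 0 := by positivity
    have hP4 : dK ^ (-(ε / 2)) =
        dK ^ (1 / 4 - ε) * dK ^ (ε / 2) * dK ^ (1 / 4 : ℝ) / dK ^ (1 / 2 : ℝ) := by
      rw [eq_div_iff hP5, hpow]
    -- powers of `2`: everything in terms of `2^{n−1}`
    have h2pow : (2 : ℝ) ^ (n - 1) * 2 = 2 ^ n := by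
      rw [← pow_succ]; congr 1; omega
    have e1 : (2 : ℝ) ^ (n + 1) = 2 ^ (n - 1) * 2 * 2 := by rw [pow_succ, ← h2pow]
    have e2 : (2 : ℝ) ^ (2 * n) = 2 ^ (n - 1) * 2 * (2 ^ (n - 1) * 2) := by
      rw [two_mul, pow_add, ← h2pow]
    have hδ0 : δ ^ (n - 1) ≠ 0 := pow_ne_zero _ hδ.ne'
    have hRF0 : regulator (maximalRealSubfield K) ≠ 0 := hRF.ne'
    have h2n : (2 : ℝ) ^ (n - 1) ≠ 0 := pow_ne_zero _ two_ne_zero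
    have hπn : Real.pi ^ n ≠ 0 := pow_ne_zero _ Real.pi_ne_zero
    have hexp : Real.exp (1 / 2) ≠ 0 := (Real.exp_pos _).ne'
    have hP1 : dK ^ (1 / 4 - ε) ≠ 0 := by positivity
    have hP2 : dK ^ (ε / 2) ≠ 0 := by positivity
    have hP3 : dK ^ (1 / 4 : ℝ) ≠ 0 := by positivity
    rw [hP4, hA_def, mul_pow, e1, e2, ← h2pow]
    field_simp
  calc C * δ ^ (n - 1) / (2 ^ (2 * n) * Real.exp (1 / 2) * Real.pi ^ n) * dK ^ (1 / 4 - ε) *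
        (classNumber (maximalRealSubfield K) : ℝ)
      ≤ C * δ ^ (n - 1) / (2 ^ (2 * n) * Real.exp (1 / 2) * Real.pi ^ n) * dK ^ (1 / 4 - ε) *
        (A * (dK ^ (ε / 2) / δ ^ (n - 1)) * (2 * dK ^ (1 / 4 : ℝ)) /
          (2 ^ n * regulator (maximalRealSubfield K))) :=
        mul_le_mul_of_nonneg_left hF_upper (by positivity)
    _ = _ := hfinal
    _ ≤ classNumber K := hK_lower


/-- **Relative class numbers of CM fields, explicit up to one exceptional quadratic field.**  For
`0 < ε ≤ 1` there is a natural number `M₀` (ONE for all degrees) such that for every `n ≥ 2` and every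
CM field `K` of degree `2n` none of whose quadratic subfields `k` has `|d_k| = M₀`:
`h_K ≥ c(n,ε)·|d_K|^{1/4−ε}·h_{K⁺}` with the explicit
`c(n,ε) = [e^{−7}16^{−2n}(C_T(ε/2)⁵/(1000(2n)!))/2]·(ε/(2(n−1)))^{n−1}/(2^{2n}e^{1/2}π^n)`,
`C_T = c_E/(2592B)` the tree's Tatuzawa constant. [cite: Stark1974, Thm. 2 (context)]
[cite: Tatuzawa1951, Thm. 2 (context)] -/
theorem exists_exceptional_classNumber_ge_explicit {ε : ℝ} (hε : 0 < ε) (hε1 : ε ≤ 1) :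
    ∃ M₀ : ℕ, ∀ (n : ℕ), 2 ≤ n → ∀ (K : Type) [Field K] [NumberField K] [IsCMField K],
      Module.finrank ℚ K = 2 * n →
      (∀ k : IntermediateField ℚ K, Module.finrank ℚ k = 2 → (discr k).natAbs ≠ M₀) →
      Real.exp (-7) * (1 / 16 : ℝ) ^ (2 * n) *
            ((Estermann.estermannC / (2592 * ballConst) * (ε / 2) ^ 5 /
              (1000 * ((2 * n).factorial : ℝ))) / 2) *
          (ε / (2 * ((n : ℝ) - 1))) ^ (n - 1) / (2 ^ (2 * n) * Real.exp (1 / 2) * Real.pi ^ n) *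
          ((discr K).natAbs : ℝ) ^ (1 / 4 - ε) * (classNumber (maximalRealSubfield K) : ℝ) ≤
        classNumber K := by
  obtain ⟨M₀, hM₀⟩ := exists_tatuzawa_exceptional_absDiscr_residue (half_pos hε) (by linarith)
  refine ⟨M₀, fun n hn K _ _ _ hK havoid ↦ ?_⟩
  have hnF : Module.finrank ℚ (maximalRealSubfield K) = n := by
    have := finrank_eq_two_mul K; omega
  have hκ := hM₀ K (by omega) havoid
  rw [hK] at hκ
  have hC : (0 : ℝ) ≤ Real.exp (-7) * (1 / 16 : ℝ) ^ (2 * n) *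
      ((Estermann.estermannC / (2592 * ballConst) * (ε / 2) ^ 5 /
        (1000 * ((2 * n).factorial : ℝ))) / 2) := by
    have h1 : 0 ≤ Estermann.estermannC := Estermann.estermannC_pos.le
    have h2 : 0 ≤ ballConst := zero_le_one.trans one_le_ballConst
    positivity
  exact classNumber_ge_of_residue_ge K hn hnF hC hε hκ

/-- **Corollary**: with the same `M₀(ε)` and `c(n,ε)`, `h_K ≥ c(n,ε)|d_K|^{1/4−ε}` for every CM field of
degree `2n ≥ 4` whose quadratic subfields avoid `M₀` — an explicit lower bound for the class number
of all CM fields but those containing the one exceptional quadratic field.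
[cite: Stark1974, Thm. 2 (context)] -/
theorem exists_exceptional_classNumber_ge_explicit' {ε : ℝ} (hε : 0 < ε) (hε1 : ε ≤ 1) :
    ∃ M₀ : ℕ, ∀ (n : ℕ), 2 ≤ n → ∀ (K : Type) [Field K] [NumberField K] [IsCMField K],
      Module.finrank ℚ K = 2 * n →
      (∀ k : IntermediateField ℚ K, Module.finrank ℚ k = 2 → (discr k).natAbs ≠ M₀) →
      Real.exp (-7) * (1 / 16 : ℝ) ^ (2 * n) *
            ((Estermann.estermannC / (2592 * ballConst) * (ε / 2) ^ 5 /
              (1000 * ((2 * n).factorial : ℝ))) / 2) *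
          (ε / (2 * ((n : ℝ) - 1))) ^ (n - 1) / (2 ^ (2 * n) * Real.exp (1 / 2) * Real.pi ^ n) *
          ((discr K).natAbs : ℝ) ^ (1 / 4 - ε) ≤ classNumber K := by
  obtain ⟨M₀, hM₀⟩ := exists_exceptional_classNumber_ge_explicit hε hε1
  refine ⟨M₀, fun n hn K _ _ _ hK havoid ↦ ?_⟩
  have h := hM₀ n hn K hK havoid
  have hF : (1 : ℝ) ≤ classNumber (maximalRealSubfield K) := by
    exact_mod_cast classNumber_pos (maximalRealSubfield K)
  have hn1 : (0 : ℝ) < (n : ℝ) - 1 := by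
    have : (2 : ℝ) ≤ n := by exact_mod_cast hn
    linarith
  have h1 : 0 ≤ Estermann.estermannC := Estermann.estermannC_pos.le
  have h2 : 0 ≤ ballConst := zero_le_one.trans one_le_ballConst
  have h0 : 0 ≤ Real.exp (-7) * (1 / 16 : ℝ) ^ (2 * n) *
            ((Estermann.estermannC / (2592 * ballConst) * (ε / 2) ^ 5 /
              (1000 * ((2 * n).factorial : ℝ))) / 2) *
          (ε / (2 * ((n : ℝ) - 1))) ^ (n - 1) / (2 ^ (2 * n) * Real.exp (1 / 2) * Real.pi ^ n) *
          ((discr K).natAbs : ℝ) ^ (1 / 4 - ε) := by positivity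
  nlinarith

end CMField

end Summit.QuantumAdvantage.QuantumAdvantage.Theorems.DegreeOnePrimesEscape

end
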